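import Summits.HodgeConjecture.HodgeConjecture.Theorems.SignSymmetricPowersClose
import Summits.HodgeConjecture.HodgeConjecture.Theorems.SignSymmetricPowersVeryGeneralSignCommutatorsInHg
import HarnessLib

/-!
# Route `SignSymmetricPowers` — the rung LEAF `SignThreefoldPowersHodge` (target item stmt-HodgeConjecture-19715) from K1

Two compositions over the route file `Theses/SignSymmetricPowers.lean` (deciding theorem `closes`):

* `signThreefoldPowersHodge_of_veryGeneralSignCommutatorsInHg` — **the target follows from crux K1 ALONE**:
  K2 `PowersHodgeOfSignCommutators` is the tree theorem `SignSymmetricPowersClose.powersHodgeOfSignCommutators`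
  (item stmt-HodgeConjecture-19717, closed `proved`), so the deciding theorem's body with K2 substituted gives
  `VeryGeneralSignCommutatorsInHg → SignThreefoldPowersHodge`, fact-free.
* `signThreefoldPowersHodge_of_facts` — **the leaf CONDITIONALLY on exactly the nine named Literature facts of K1-B**
  (Voisin II 6.10/6.12 equivariant eigen-Hodge numbers, Zariski–van Kampen meridian generation, Picard–Lefschetz for
  nodal forms, Deligne's global invariant cycles, local branches of the discriminant at nodal forms, the
  Cattani–Deligne–Kaplan cover of non-Hodge-generic points, CMSP 15.3.7 (ii) `Mon⁰ ⊆ MT`, the symmetric-`A₃`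
  Picard–Lefschetz confluence, conjugacy of meridians of one component), via the conditional closing composition
  `SignSymmetricPowersVeryGeneralSignCommutatorsInHg.veryGeneralSignCommutatorsInHg_of_facts` (p576823).

Honest framing: the target item stmt-HodgeConjecture-19715 and the crux K1 stmt-HodgeConjecture-19716 stay OPEN; they close
exactly when the nine facts are discharged in the tree.  No new mathematics here (pure logic over landed theorems).
-/

set_option linter.dupNamespace false

namespace Summit.HodgeConjecture.HodgeConjecture.Theorems.SignSymmetricPowersSignThreefoldPowersHodge

open Summit.HodgeConjecture.HodgeConjecture.Theses.SignSymmetricPowers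

/-- **The rung leaf from K1 alone**: `VeryGeneralSignCommutatorsInHg → SignThreefoldPowersHodge`, with K2
`PowersHodgeOfSignCommutators` supplied by the tree theorem `SignSymmetricPowersClose.powersHodgeOfSignCommutators`
(the deciding theorem `SignSymmetricPowers.closes` minus its sector-complement line). -/
theorem signThreefoldPowersHodge_of_veryGeneralSignCommutatorsInHg (h₁ : VeryGeneralSignCommutatorsInHg) :
    SignThreefoldPowersHodge := by
  intro d hd h4
  obtain ⟨g, hg₀, hg⟩ := h₁ hd h4
  refine ⟨g, hg₀, ?_⟩
  intro f hf hev hgen X hX hcut k Y hY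
  exact SignSymmetricPowersClose.powersHodgeOfSignCommutators hd h4 hX ⟨f, hf, hev, hcut⟩ (hg f hf hev hgen hX hcut) hY

/-- **The rung leaf `SignThreefoldPowersHodge` modulo the nine named facts of K1-B**: composition of
`signThreefoldPowersHodge_of_veryGeneralSignCommutatorsInHg` with the conditional closing composition
`veryGeneralSignCommutatorsInHg_of_facts` of crux K1 (stmt-HodgeConjecture-19716).  CONDITIONAL result — its trust
base is the nine named `def … : Prop` facts, none discharged in the tree at the time of writing. -/
theorem signThreefoldPowersHodge_of_facts
    (hV : Literature.AlgebraicGeometry.HodgeTheory.voisin2003_finrank_eigenspace_inf_hodgePiece_of_diagonalStabilizer)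
    (hZvK : Literature.AlgebraicGeometry.FundamentalGroup.affineHypersurfaceComplement_meridians_normalClosure_eq_top)
    (hPL : Literature.AlgebraicGeometry.HodgeTheory.picardLefschetz_nodalForms_uniform)
    (hGIC : Literature.AlgebraicGeometry.HodgeTheory.deligne_globalInvariantCycles)
    (hD1 : Literature.AlgebraicGeometry.HodgeTheory.discriminant_localBranches_nodal)
    (hCDK : Literature.AlgebraicGeometry.HodgeTheory.cmsp_nonHodgeGenericPoints_countable_algebraic_cover)
    (h1537 : Literature.AlgebraicGeometry.HodgeTheory.deligne_finiteIndex_monodromy_le_mumfordTateGroup)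
    (hB2 : Literature.AlgebraicGeometry.HodgeTheory.picardLefschetz_symmetricA3)
    (hMC : Literature.AlgebraicGeometry.FundamentalGroup.affineHypersurfaceComplement_meridian_isConj) :
    SignThreefoldPowersHodge :=
  signThreefoldPowersHodge_of_veryGeneralSignCommutatorsInHg
    (SignSymmetricPowersVeryGeneralSignCommutatorsInHg.veryGeneralSignCommutatorsInHg_of_facts
      @hV @hZvK @hPL @hGIC @hD1 @hCDK @h1537 @hB2 @hMC)

end Summit.HodgeConjecture.HodgeConjecture.Theorems.SignSymmetricPowersSignThreefoldPowersHodge
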